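import Summits.FinalStateConjecture.FinalStateConjecture.Theorems.EIHFluxBalanceInertialRecessionRechartWhiteHoleKerrExclusion
import Summits.FinalStateConjecture.FinalStateConjecture.Theorems.EIHFluxBalanceInertialRecessionStubRechart3Frames
import Summits.FinalStateConjecture.FinalStateConjecture.Theorems.EIHFluxBalanceInertialRecessionRechartOfut

/-!
# Route EIHFluxBalance — `InertialRecession`, re-charting: the painted frames are ORTHOCHRONOUS
# (the orientation clause (O) of `stub_rechart`, for all spins, from lab-time causality)

Helper file for the crux `stmt-FinalStateConjecture-10166`
(`Summit.FinalStateConjecture.FinalStateConjecture.Theses.EIHFluxBalance.InertialRecession`),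
stub `stub_rechart` of line `sublinear-is-free-clean-window-charges`.

`lorentz_apply_zero_pos_of_labTime` — from EXACTLY the antecedent clauses of `stub_rechart`
(subextremal holes, bounded Lorentz factors, smooth painted motions, separation, the lab chart with
its late-region open embedding and `C³` deviation decay, `O = exteriorOf …`, image and exhaustion
clauses), the output `Slaved³` of `stub_slaving`, and eventual LAB-TIME CAUSALITY of the chart (the
conclusion of `stub_labTimeCausality`): every painted frame is orthochronous,
`∀ i t, 0 < (Λᵢ(t)e₀)⁰`. NO Cesàro clause and NO convergence of velocities is used. This is the
hypothesis `hpos` of the general-spin analytic package `SublinearIsFree.Rechart.rechart_analytic_package`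
(…StubRechart3G1), which therefore needs no orientation clause.

Proof: the sign of `(Λᵢ(t)e₀)⁰` is constant (`|·| ≥ 1`, continuity; `lorentz_apply_zero_pos_of_exists`); if negative, hole `i` is a
painted WHITE hole of spin `aᵢ`, excluded by `false_of_antiOrthochronous_hole_spin`
(…RechartWhiteHoleKerrExclusion) once a normalised representative `Q` of the frame modulo the
Kerr–Schild stabiliser with vanishing drift is supplied: apply the lead's frame normalisation
`exists_normalisedFrame'` (…StubRechart3Frames) to the rest-frame ANTIPODAL companion
`Λ♭ = Λᵢ·(−1)` (orthochronous, same slaving), and flip back, `Q = Λ'·(−1)`; the painted form and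
radius of `Λ·(−1)` at `x` are those of `Λ` at the reflected point `2c − x`
(`boostedKerrBilin_mul_negL`), so the normalisation transfers; the drift of `Q` vanishes with the
first derivative of `Λ'` (`exists_window_le_of_tendsto_deriv`). (Ofut) comes from lab-time causality
(`isFutureDirected_mfderiv_of_labTimeCausality`).

[O'Neill 1983, Ch. 9, p. 233; Ch. 14; folklore]
-/

noncomputable section

set_option linter.dupNamespace false

open scoped Topology Manifold ContDiff BigOperators
open Set Function Filter Metric Topology TopologicalSpace Literature.Geometry.Lorentzian

namespace Summit.FinalStateConjecture.FinalStateConjecture.Theorems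

/-- Local copy (the original `lorentz_apply_zero_pos_of_exists` lives in a module broken by the
2026-08-16 `HasExhaustiveCharts` change): a continuous Lorentz frame orthochronous at one time is
orthochronous at all times. [folklore] -/
private theorem lorentz_apply_zero_pos_of_exists' {Λ : ℝ → lorentzGroup}
    (hc : Continuous fun t ↦ ((Λ t : E4 ≃L[ℝ] E4) : E4 →L[ℝ] E4))
    (h : ∃ t, 0 < (((Λ t : E4 ≃L[ℝ] E4) (E4.basisVector 0)) 0)) (t : ℝ) :
    0 < (((Λ t : E4 ≃L[ℝ] E4) (E4.basisVector 0)) 0) := by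
  obtain ⟨t₀, ht₀⟩ := h
  by_contra hle
  rw [not_lt] at hle
  have hcont : Continuous fun s ↦ (((Λ s : E4 ≃L[ℝ] E4) (E4.basisVector 0)) 0) :=
    (EuclideanSpace.proj (0 : Fin 4) : E4 →L[ℝ] ℝ).continuous.comp (hc.clm_apply continuous_const)
  have hmem : (0 : ℝ) ∈ uIcc (((Λ t₀ : E4 ≃L[ℝ] E4) (E4.basisVector 0)) 0)
      (((Λ t : E4 ≃L[ℝ] E4) (E4.basisVector 0)) 0) :=
    mem_uIcc.mpr (Or.inr ⟨hle, ht₀.le⟩)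
  obtain ⟨s, -, hs⟩ := intermediate_value_uIcc hcont.continuousOn hmem
  have h1 := one_le_abs_lorentz_apply_zero (Λ s)
  have hs' : (((Λ s : E4 ≃L[ℝ] E4) (E4.basisVector 0)) 0) = 0 := hs
  rw [hs', abs_zero] at h1
  linarith


/-! ### The antipodal companion of a frame -/

/-- Negation `v ↦ −v` preserves the Minkowski form. [folklore] -/
theorem neg_mem_lorentzGroup : (ContinuousLinearEquiv.neg ℝ : E4 ≃L[ℝ] E4) ∈ lorentzGroup :=
  fun v w ↦ by simp only [ContinuousLinearEquiv.neg_apply, map_neg, neg_neg, neg_apply]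

/-- The antipodal companion `Λ·(−1)` acts by `v ↦ −Λv`, its inverse by `v ↦ −Λ⁻¹v`, and as an
operator it is `−Λ`; `Λ·(−1)·(−1) = Λ`. [folklore] -/
theorem mul_negL_apply (Λ : lorentzGroup) :
    (∀ v : E4, ((Λ * ⟨ContinuousLinearEquiv.neg ℝ, neg_mem_lorentzGroup⟩ : lorentzGroup) : E4 ≃L[ℝ] E4) v =
        -(Λ : E4 ≃L[ℝ] E4) v) ∧
      (∀ v : E4, ((Λ * ⟨ContinuousLinearEquiv.neg ℝ, neg_mem_lorentzGroup⟩ : lorentzGroup) :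
          E4 ≃L[ℝ] E4).symm v = -(Λ : E4 ≃L[ℝ] E4).symm v) ∧
      ((((Λ * ⟨ContinuousLinearEquiv.neg ℝ, neg_mem_lorentzGroup⟩ : lorentzGroup) : E4 ≃L[ℝ] E4) :
          E4 →L[ℝ] E4) = -((Λ : E4 ≃L[ℝ] E4) : E4 →L[ℝ] E4)) ∧
      Λ * ⟨ContinuousLinearEquiv.neg ℝ, neg_mem_lorentzGroup⟩ *
          ⟨ContinuousLinearEquiv.neg ℝ, neg_mem_lorentzGroup⟩ = Λ := by
  have h1 : ∀ v : E4, ((Λ * ⟨ContinuousLinearEquiv.neg ℝ, neg_mem_lorentzGroup⟩ : lorentzGroup) :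
      E4 ≃L[ℝ] E4) v = -(Λ : E4 ≃L[ℝ] E4) v := fun v ↦ by
    show (Λ : E4 ≃L[ℝ] E4) ((ContinuousLinearEquiv.neg ℝ : E4 ≃L[ℝ] E4) v) = _
    rw [ContinuousLinearEquiv.neg_apply, map_neg]
  have h2 : ∀ v : E4, ((Λ * ⟨ContinuousLinearEquiv.neg ℝ, neg_mem_lorentzGroup⟩ : lorentzGroup) :
      E4 ≃L[ℝ] E4).symm v = -(Λ : E4 ≃L[ℝ] E4).symm v := fun v ↦ by
    show (ContinuousLinearEquiv.neg ℝ : E4 ≃L[ℝ] E4).symm ((Λ : E4 ≃L[ℝ] E4).symm v) = _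
    rw [ContinuousLinearEquiv.symm_neg, ContinuousLinearEquiv.neg_apply]
  refine ⟨h1, h2, ?_, ?_⟩
  · ext v
    rw [ContinuousLinearEquiv.coe_coe, h1, neg_apply, ContinuousLinearEquiv.coe_coe]
  · refine Subtype.ext (ContinuousLinearEquiv.ext (funext fun v ↦ ?_))
    show ((Λ * ⟨ContinuousLinearEquiv.neg ℝ, neg_mem_lorentzGroup⟩ : lorentzGroup) : E4 ≃L[ℝ] E4)
      ((ContinuousLinearEquiv.neg ℝ : E4 ≃L[ℝ] E4) v) = (Λ : E4 ≃L[ℝ] E4) v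
    rw [h1, ContinuousLinearEquiv.neg_apply, map_neg, neg_neg]

/-- **The painted form of the antipodal companion is the painted form at the reflected point**:
`boostedKerrBilin (Λ·(−1)) c M a x = boostedKerrBilin Λ c M a (2c − x)` (rest position `−Λ⁻¹(x − c)`,
frame vectors negated twice). [folklore] -/
theorem boostedKerrBilin_mul_negL (Λ : lorentzGroup) (c : E4) (M a : ℝ) (x : E4) :
    boostedKerrBilin (Λ * ⟨ContinuousLinearEquiv.neg ℝ, neg_mem_lorentzGroup⟩) c M a x =
      boostedKerrBilin Λ c M a ((2 : ℝ) • c - x) := by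
  obtain ⟨-, h2, -, -⟩ := mul_negL_apply Λ
  ext v w
  have hx : (Λ : E4 ≃L[ℝ] E4).symm ((2 : ℝ) • c - x - c) = -(Λ : E4 ≃L[ℝ] E4).symm (x - c) := by
    rw [← map_neg, neg_sub, show (2 : ℝ) • c - x - c = c - x by rw [two_smul]; abel]
  rw [boostedKerrBilin_apply, boostedKerrBilin_apply, poincareInv, poincareInv, h2, h2, h2, hx]
  simp only [map_neg, neg_apply, neg_neg]

/-- The painted radius of the antipodal companion is the painted radius at the reflected point.
[folklore] -/
theorem radius_poincareInv_mul_negL (Λ : lorentzGroup) (c : E4) (a : ℝ) (x : E4) :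
    Kerr.radius a (poincareInv (Λ * ⟨ContinuousLinearEquiv.neg ℝ, neg_mem_lorentzGroup⟩) c x) =
      Kerr.radius a (poincareInv Λ c ((2 : ℝ) • c - x)) := by
  obtain ⟨-, h2, -, -⟩ := mul_negL_apply Λ
  rw [poincareInv, poincareInv, h2, ← map_neg, neg_sub, show (2 : ℝ) • c - x - c = c - x by
    rw [two_smul]; abel]

/-! ### A normalised representative modulo the stabiliser, for anti-orthochronous frames -/

/-- **Stabiliser-normalised representative of an anti-orthochronous painted frame.** Let `Λ(t)` be
a smooth Lorentz frame with bounded Lorentz factor, PAST-pointing `Λe₀`, derivatives of orders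
`1 … 3` of `Λe₀` tending to `0`, and — if `a ≠ 0` — the same for the axis `Λe₃`. Then there is a
frame `Q(t)` with the same `e₀` column, the same painted form `boostedKerrBilin` and painted radius
for `(M, a)` at every centre and point, and drift over bounded windows tending to zero. (Apply
`exists_normalisedFrame'` to the antipodal companion `Λ·(−1)` and flip back.) [folklore] -/
theorem exists_stabiliserFrame_of_neg (Λ : ℝ → lorentzGroup) (γ M a : ℝ)
    (hΛ : ContDiff ℝ ∞ (fun t ↦ ((Λ t : E4 ≃L[ℝ] E4) : E4 →L[ℝ] E4)))
    (hγ : ∀ t, |((Λ t : E4 ≃L[ℝ] E4) (E4.basisVector 0)) 0| ≤ γ)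
    (hneg : ∀ t, ((Λ t : E4 ≃L[ℝ] E4) (E4.basisVector 0)) 0 < 0)
    (hu : ∀ m, 1 ≤ m → m ≤ 3 → Tendsto (fun t ↦ iteratedDeriv m
      (fun s ↦ (Λ s : E4 ≃L[ℝ] E4) (E4.basisVector 0)) t) atTop (𝓝 0))
    (hs : a ≠ 0 → ∀ m, 1 ≤ m → m ≤ 3 → Tendsto (fun t ↦ iteratedDeriv m
      (fun s ↦ (Λ s : E4 ≃L[ℝ] E4) (E4.basisVector 3)) t) atTop (𝓝 0)) :
    ∃ Q : ℝ → lorentzGroup,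
      (∀ t, (Q t : E4 ≃L[ℝ] E4) (E4.basisVector 0) = (Λ t : E4 ≃L[ℝ] E4) (E4.basisVector 0)) ∧
      (∀ t c x, boostedKerrBilin (Λ t) c M a x = boostedKerrBilin (Q t) c M a x) ∧
      (∀ t c x, Kerr.radius a (poincareInv (Λ t) c x) = Kerr.radius a (poincareInv (Q t) c x)) ∧
      (∀ L δ : ℝ, 0 < L → 0 < δ → ∃ T : ℝ, ∀ t₀ t : ℝ, T ≤ t₀ → |t - t₀| ≤ L →
        ‖((Q t : E4 ≃L[ℝ] E4) : E4 →L[ℝ] E4) - ((Q t₀ : E4 ≃L[ℝ] E4) : E4 →L[ℝ] E4)‖ ≤ δ) := by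
  set nL : lorentzGroup := ⟨ContinuousLinearEquiv.neg ℝ, neg_mem_lorentzGroup⟩ with hnL
  -- the antipodal companion
  set Λf : ℝ → lorentzGroup := fun t ↦ Λ t * nL with hΛf
  have happ : ∀ t v, (Λf t : E4 ≃L[ℝ] E4) v = -(Λ t : E4 ≃L[ℝ] E4) v := fun t ↦ (mul_negL_apply (Λ t)).1
  have hclm : ∀ t, ((Λf t : E4 ≃L[ℝ] E4) : E4 →L[ℝ] E4) = -((Λ t : E4 ≃L[ℝ] E4) : E4 →L[ℝ] E4) :=
    fun t ↦ (mul_negL_apply (Λ t)).2.2.1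
  have hΛf_smooth : ContDiff ℝ ∞ (fun t ↦ ((Λf t : E4 ≃L[ℝ] E4) : E4 →L[ℝ] E4)) := by
    have : (fun t ↦ ((Λf t : E4 ≃L[ℝ] E4) : E4 →L[ℝ] E4)) = fun t ↦ -((Λ t : E4 ≃L[ℝ] E4) : E4 →L[ℝ] E4) :=
      funext hclm
    rw [this]; exact hΛ.neg
  have hγf : ∀ t, |((Λf t : E4 ≃L[ℝ] E4) (E4.basisVector 0)) 0| ≤ γ := fun t ↦ by
    rw [happ, PiLp.neg_apply, abs_neg]; exact hγ t
  have hposf : ∀ t, 0 < ((Λf t : E4 ≃L[ℝ] E4) (E4.basisVector 0)) 0 := fun t ↦ by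
    rw [happ, PiLp.neg_apply]; linarith [hneg t]
  have hcol : ∀ (μ : Fin 4) (m : ℕ) (t : ℝ), iteratedDeriv m (fun s ↦ (Λf s : E4 ≃L[ℝ] E4) (E4.basisVector μ)) t =
      -iteratedDeriv m (fun s ↦ (Λ s : E4 ≃L[ℝ] E4) (E4.basisVector μ)) t := fun μ m t ↦ by
    have : (fun s ↦ (Λf s : E4 ≃L[ℝ] E4) (E4.basisVector μ)) =
        fun s ↦ -(Λ s : E4 ≃L[ℝ] E4) (E4.basisVector μ) := funext fun s ↦ happ s _
    rw [this, iteratedDeriv_fun_neg]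
  have huf : ∀ m, 1 ≤ m → m ≤ 3 → Tendsto (fun t ↦ iteratedDeriv m
      (fun s ↦ (Λf s : E4 ≃L[ℝ] E4) (E4.basisVector 0)) t) atTop (𝓝 0) := fun m h1 h3 ↦ by
    simp only [hcol]; simpa using (hu m h1 h3).neg
  have hsf : a ≠ 0 → ∀ m, 1 ≤ m → m ≤ 3 → Tendsto (fun t ↦ iteratedDeriv m
      (fun s ↦ (Λf s : E4 ≃L[ℝ] E4) (E4.basisVector 3)) t) atTop (𝓝 0) := fun ha m h1 h3 ↦ by
    simp only [hcol]; simpa using (hs ha m h1 h3).neg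
  obtain ⟨Λ', hΛ's, hΛ'0, hΛ'dec, hΛ'bil, hΛ'rad⟩ :=
    SublinearIsFree.Rechart.exists_normalisedFrame' Λf γ M a hΛf_smooth hγf hposf huf hsf
  -- flip back
  refine ⟨fun t ↦ Λ' t * nL, fun t ↦ ?_, fun t c x ↦ ?_, fun t c x ↦ ?_, fun L δ hL hδ ↦ ?_⟩
  · rw [(mul_negL_apply (Λ' t)).1, hΛ'0 t, happ, neg_neg]
  · show boostedKerrBilin (Λ t) c M a x = boostedKerrBilin (Λ' t * nL) c M a x
    rw [boostedKerrBilin_mul_negL, ← hΛ'bil, boostedKerrBilin_mul_negL, sub_sub_cancel]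
  · show Kerr.radius a (poincareInv (Λ t) c x) = Kerr.radius a (poincareInv (Λ' t * nL) c x)
    rw [radius_poincareInv_mul_negL, ← hΛ'rad, radius_poincareInv_mul_negL, sub_sub_cancel]
  · -- drift from the first derivative of `Λ'`
    have hdiff : Differentiable ℝ (fun t ↦ -((Λ' t : E4 ≃L[ℝ] E4) : E4 →L[ℝ] E4)) :=
      (hΛ's.differentiable (by simp)).neg
    have hder : Tendsto (deriv (fun t ↦ -((Λ' t : E4 ≃L[ℝ] E4) : E4 →L[ℝ] E4))) atTop (𝓝 0) := by
      have h1 := hΛ'dec 1 le_rfl (by norm_num)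
      simp only [iteratedDeriv_one] at h1
      rw [deriv.fun_neg']
      simpa using h1.neg
    obtain ⟨T, hT⟩ := exists_window_le_of_tendsto_deriv hdiff hder hL hδ
    refine ⟨T, fun t₀ t ht₀ ht ↦ ?_⟩
    show ‖(((Λ' t * nL : lorentzGroup) : E4 ≃L[ℝ] E4) : E4 →L[ℝ] E4) -
      (((Λ' t₀ * nL : lorentzGroup) : E4 ≃L[ℝ] E4) : E4 →L[ℝ] E4)‖ ≤ δ
    rw [(mul_negL_apply (Λ' t)).2.2.1, (mul_negL_apply (Λ' t₀)).2.2.1]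
    exact hT t₀ t ht₀ ht

/-! ### The orientation theorem -/

section Orientation

variable {X : Type} [TopologicalSpace X] [ChartedSpace E3 X] [IsManifold (𝓡 3) ∞ X]
  [ConnectedSpace X] {D : InitialDataSet (𝓡 3) X}

-- long statement and bookkeeping proof
set_option maxHeartbeats 1600000 in
/-- **The painted frames are orthochronous** (the clause (O) of `stub_rechart`, for all spins, from
the antecedent, `Slaved³` and lab-time causality). See the module docstring. [folklore] -/
theorem lorentz_apply_zero_pos_of_labTime (𝒟 : VacuumCauchyDevelopment D) {N : ℕ} (M a rin : Fin N → ℝ)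
    (Λ : Fin N → ℝ → lorentzGroup) (ξ : Fin N → ℝ → E3) (γ τ₀ : ℝ) (U : Opens E4) (Φ : U → 𝒟.carrier)
    (O : Set 𝒟.carrier)
    (hsub : ∀ i, Kerr.IsSubextremal (M i) (a i) ∧ Kerr.rMinus (M i) (a i) < rin i ∧ rin i < Kerr.rPlus (M i) (a i))
    (hγ : ∀ i t, |((Λ i t : E4 ≃L[ℝ] E4) (E4.basisVector 0)) 0| ≤ γ)
    (hsm : ∀ i, ContDiff ℝ ∞ (ξ i) ∧ ContDiff ℝ ∞ (fun t ↦ ((Λ i t : E4 ≃L[ℝ] E4) : E4 →L[ℝ] E4)))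
    (hsep : ∀ i j, i ≠ j → Tendsto (fun t ↦ ‖ξ i t - ξ j t‖) atTop atTop)
    (hU : {x : E4 | τ₀ < x 0 ∧ ∀ i, rin i < Kerr.radius (a i)
      (poincareInv (Λ i (x 0)) (E4.ofTimeSpace (x 0) (ξ i (x 0))) x)} ⊆ (U : Set E4))
    (hΦ : ContMDiff 𝓘(ℝ, E4) (𝓡 4) ∞ Φ)
    (hemb : Topology.IsOpenEmbedding (((⟨U, fun x ↦ Minkowski.bilin +
      ∑ i, (boostedKerrBilin (Λ i (x 0)) (E4.ofTimeSpace (x 0) (ξ i (x 0))) (M i) (a i) x -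
        Minkowski.bilin), fun x ↦ x 0, E4.spatialNorm⟩ : ModelBackground).lateRegion τ₀).restrict Φ))
    (himO : Φ '' {x : U | τ₀ < x.1 0 ∧ ∀ i, Kerr.rPlus (M i) (a i) < Kerr.radius (a i)
      (poincareInv (Λ i (x.1 0)) (E4.ofTimeSpace (x.1 0) (ξ i (x.1 0))) x.1)} ⊆ O)
    (hdev : Tendsto (fun t ↦ 𝒟.toSpacetime.deviationCk ⟨U, fun x ↦ Minkowski.bilin +
      ∑ i, (boostedKerrBilin (Λ i (x 0)) (E4.ofTimeSpace (x 0) (ξ i (x 0))) (M i) (a i) x -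
        Minkowski.bilin), fun x ↦ x 0, E4.spatialNorm⟩ Φ 3 t) atTop (𝓝 0))
    (hO : O = Summit.FinalStateConjecture.exteriorOf 𝒟.toCauchyDevelopment (Φ '' {x : U | τ₀ < x.1 0 ∧
      ∀ i, Kerr.rPlus (M i) (a i) < Kerr.radius (a i) (poincareInv (Λ i (x.1 0))
        (E4.ofTimeSpace (x.1 0) (ξ i (x.1 0))) x.1)}))
    (hexh : ∀ t₁ : ℝ, τ₀ < t₁ → O \ Φ '' {x : U | t₁ < x.1 0 ∧ ∀ i, Kerr.rPlus (M i) (a i) <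
      Kerr.radius (a i) (poincareInv (Λ i (x.1 0)) (E4.ofTimeSpace (x.1 0) (ξ i (x.1 0))) x.1)} ⊆
      𝒟.metric.causalPast 𝒟.timeOrientation (Φ '' {x : U | x.1 0 = t₁ ∧ ∀ i, Kerr.rPlus (M i) (a i) <
        Kerr.radius (a i) (poincareInv (Λ i (x.1 0)) (E4.ofTimeSpace (x.1 0) (ξ i (x.1 0))) x.1)}))
    (Slaved : ∀ i : Fin N, (∀ m : ℕ, 1 ≤ m → m ≤ 3 → Tendsto (fun t ↦ iteratedDeriv m
        (fun s ↦ ((Λ i s : E4 ≃L[ℝ] E4) (E4.basisVector 0))) t) atTop (𝓝 0)) ∧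
      (∀ m : ℕ, m ≤ 2 → Tendsto (fun t ↦ iteratedDeriv m (fun s ↦ deriv (ξ i) s -
        ((((Λ i s : E4 ≃L[ℝ] E4) (E4.basisVector 0)) 0)⁻¹ •
          E4.spatial ((Λ i s : E4 ≃L[ℝ] E4) (E4.basisVector 0)))) t) atTop (𝓝 0)) ∧
      (a i ≠ 0 → ∀ m : ℕ, 1 ≤ m → m ≤ 3 → Tendsto (fun t ↦ iteratedDeriv m
        (fun s ↦ ((Λ i s : E4 ≃L[ℝ] E4) (E4.basisVector 3))) t) atTop (𝓝 0)))
    (hT : ∃ τ₁ : ℝ, ∀ x y : U, (τ₁ < x.1 0 ∧ ∀ i, rin i < Kerr.radius (a i) (poincareInv (Λ i (x.1 0))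
      (E4.ofTimeSpace (x.1 0) (ξ i (x.1 0))) x.1)) → (τ₁ < y.1 0 ∧ ∀ i, rin i < Kerr.radius (a i)
      (poincareInv (Λ i (y.1 0)) (E4.ofTimeSpace (y.1 0) (ξ i (y.1 0))) y.1)) →
      Φ y ∈ 𝒟.metric.causalFuture 𝒟.timeOrientation {Φ x} → x.1 0 ≤ y.1 0) :
    ∀ (i : Fin N) (t : ℝ), 0 < ((Λ i t : E4 ≃L[ℝ] E4) (E4.basisVector 0)) 0 := by
  obtain ⟨τ₁, hT₁⟩ := hT
  -- (Ofut) from lab-time causality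
  have hOfut : ∀ x : U, max τ₀ τ₁ < x.1 0 → (∀ j, rin j < Kerr.radius (a j)
      (poincareInv (Λ j (x.1 0)) (E4.ofTimeSpace (x.1 0) (ξ j (x.1 0))) x.1)) → ∀ w : E4, 0 < w 0 →
      𝒟.metric.val (Φ x) (mfderiv 𝓘(ℝ, E4) (𝓡 4) Φ x w) (mfderiv 𝓘(ℝ, E4) (𝓡 4) Φ x w) < 0 →
        𝒟.timeOrientation.IsFutureDirected (mfderiv 𝓘(ℝ, E4) (𝓡 4) Φ x w) := by
    intro x hx hrad w hw htl
    have hopen := isOpen_setOf_lt_radius_poincareInv a rin Λ ξ (max τ₀ τ₁)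
      (fun i ↦ (hsm i).2.continuous) (fun i ↦ (hsm i).1.continuous)
    exact isFutureDirected_mfderiv_of_labTimeCausality hΦ hopen
      (fun z hz ↦ hU ⟨(le_max_left _ _).trans_lt hz.1, hz.2⟩)
      (fun x' y' hx' hy' hJ ↦ hT₁ x' y' ⟨(le_max_right _ _).trans_lt hx'.1, hx'.2⟩
        ⟨(le_max_right _ _).trans_lt hy'.1, hy'.2⟩ hJ) x ⟨hx, hrad⟩ hw htl
  intro i
  by_cases hex : ∃ t, 0 < ((Λ i t : E4 ≃L[ℝ] E4) (E4.basisVector 0)) 0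
  · exact lorentz_apply_zero_pos_of_exists' (hsm i).2.continuous hex
  · exfalso
    have hneg : ∀ t, ((Λ i t : E4 ≃L[ℝ] E4) (E4.basisVector 0)) 0 < 0 := by
      intro t
      have hle : ((Λ i t : E4 ≃L[ℝ] E4) (E4.basisVector 0)) 0 ≤ 0 := not_lt.mp fun h ↦ hex ⟨t, h⟩
      have h1 := one_le_abs_lorentz_apply_zero (Λ i t)
      rcases hle.lt_or_eq with h | h
      · exact h
      · rw [h, abs_zero] at h1; linarith
    -- the normalised representative of the frame of hole `i`
    obtain ⟨Q, hQ0, hQbil, hQrad, hQdrift⟩ := exists_stabiliserFrame_of_neg (Λ i) γ (M i) (a i)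
      (hsm i).2 (hγ i) hneg (Slaved i).1 (Slaved i).2.2
    have hmis : Tendsto (fun t ↦ deriv (ξ i) t - ((((Λ i t : E4 ≃L[ℝ] E4) (E4.basisVector 0)) 0)⁻¹ •
        E4.spatial ((Λ i t : E4 ≃L[ℝ] E4) (E4.basisVector 0)))) atTop (𝓝 0) := by
      simpa using (Slaved i).2.1 0 (Nat.zero_le 2)
    have hembΦ : IsOpenEmbedding (({x : U | τ₀ < x.1 0} : Set U).restrict Φ) := hemb
    exact false_of_antiOrthochronous_hole_spin 𝒟 i M a rin Λ ξ (hsub i).1.pos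
      (fun j ↦ (hsub j).2.2) hγ (fun j ↦ (hsm j).2.continuous) (fun j ↦ (hsm j).1.continuous)
      ((hsm i).1.differentiable (by simp)) Q hQ0 hQbil hQrad hQdrift hmis hneg
      (fun j hj ↦ hsep i j (Ne.symm hj)) U Φ hΦ hU hembΦ hdev O hO himO hexh
      (fun x y hx hy hJ ↦ hT₁ x y hx hy hJ) hOfut

end Orientation

/-! ### The orientation theorem in the format of the stub -/

-- long statement
set_option maxHeartbeats 800000 in
/-- **Orientation from the crux antecedent, `Slaved³` and lab-time causality** — the same theorem
with the antecedent of `InertialRecession` bundled VERBATIM (as the stubs of the line state it), the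
`Slaved³` block of `stub_slaving` and the conclusion of `stub_labTimeCausality`. [folklore] -/
theorem orientation_of_antecedent : ∀ (X : Type) [TopologicalSpace X] [ChartedSpace E3 X] [IsManifold (𝓡 3) ((⊤ : ℕ∞) : WithTop ℕ∞) X] [T2Space X] [SecondCountableTopology X] [ConnectedSpace X], ∀ D ∈ admissibleVacuumData X, ∀ 𝒟 : VacuumCauchyDevelopment D, 𝒟.IsMaximal → ∀ (N : ℕ) (M a rin : Fin N → ℝ) (Λ : Fin N → ℝ → lorentzGroup) (ξ : Fin N → ℝ → E3) (γ κ τ₀ : ℝ) (U : Opens E4) (Φ : U → 𝒟.carrier) (O : Set 𝒟.carrier), ((∀ i, Kerr.IsSubextremal (M i) (a i) ∧ Kerr.rMinus (M i) (a i) < rin i ∧ rin i < Kerr.rPlus (M i) (a i)) ∧ (∀ i t, |((Λ i t : E4 ≃L[ℝ] E4) (E4.basisVector 0)) 0| ≤ γ) ∧ (∀ i, ContDiff ℝ ((⊤ : ℕ∞) : WithTop ℕ∞) (ξ i) ∧ ContDiff ℝ ((⊤ : ℕ∞) : WithTop ℕ∞) (fun t ↦ ((Λ i t : E4 ≃L[ℝ]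 E4) : E4 →L[ℝ] E4))) ∧ (∀ i j, i ≠ j → Tendsto (fun t ↦ ‖ξ i t - ξ j t‖) atTop atTop) ∧ (0 < κ ∧ κ < 1 ∧ ∀ i, ∀ᶠ t in atTop, ‖ξ i t‖ ≤ κ ^ 2 * t) ∧ ({x : E4 | τ₀ < x 0 ∧ ∀ i, rin i < Kerr.radius (a i) (poincareInv (Λ i (x 0)) (E4.ofTimeSpace (x 0) (ξ i (x 0))) x)} ⊆ (U : Set E4)) ∧ let B : ModelBackground := ⟨U, fun x ↦ Minkowski.bilin + ∑ i, (boostedKerrBilin (Λ i (x 0)) (E4.ofTimeSpace (x 0) (ξ i (x 0))) (M i) (a i) x - Minkowski.bilin), fun x ↦ x 0, E4.spatialNorm⟩; ContMDiff 𝓘(ℝ, E4) (𝓡 4) ((⊤ : ℕ∞) : WithTop ℕ∞) Φ ∧ Topology.IsOpenEmbedding ((B.lateRegion τ₀).restrict Φ) ∧ Φ '' {x : U | τ₀ < x.1 0 ∧ ∀ i, Kerr.rPlus (M i) (a i) < Kerr.radius (a i) (poincareInv (Λ i (x.1 0)) (E4.ofTimeSpace (x.1 0) (ξ i (x.1 0)))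 x.1)} ⊆ O ∧ Tendsto (fun t ↦ 𝒟.toSpacetime.deviationCk B Φ 3 t) atTop (𝓝 0) ∧ Tendsto (fun t : ℝ ↦ ⨆ x ∈ {x : U | x.1 0 = t ∧ E4.spatialNorm x.1 ≤ κ * t}, ⨆ (m : ℕ) (_ : m ≤ 3), ENNReal.ofReal (1 + √(√((⨅ i, ‖E4.spatial x.1 - ξ i t‖) ^ 7))) * ‖iteratedFDeriv ℝ m (𝒟.toSpacetime.deviationExtend B Φ) x.1‖ₑ) atTop (𝓝 0) ∧ O = Summit.FinalStateConjecture.exteriorOf 𝒟.toCauchyDevelopment (Φ '' {x : U | τ₀ < x.1 0 ∧ ∀ i, Kerr.rPlus (M i) (a i) < Kerr.radius (a i) (poincareInv (Λ i (x.1 0)) (E4.ofTimeSpace (x.1 0) (ξ i (x.1 0))) x.1)}) ∧ ∀ t₁ : ℝ, τ₀ < t₁ → O \ Φ '' {x : U | t₁ < x.1 0 ∧ ∀ i, Kerr.rPlus (M i) (a i) < Kerr.radius (a i) (poincareInv (Λ i (x.1 0)) (E4.ofTimeSpace (x.1 0) (ξ i (x.1 0))) x.1)} ⊆ 𝒟.metric.causalPast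 𝒟.timeOrientation (Φ '' {x : U | x.1 0 = t₁ ∧ ∀ i, Kerr.rPlus (M i) (a i) < Kerr.radius (a i) (poincareInv (Λ i (x.1 0)) (E4.ofTimeSpace (x.1 0) (ξ i (x.1 0))) x.1)})) →
    (∀ i : Fin N, (∀ m : ℕ, 1 ≤ m → m ≤ 3 → Tendsto (fun t ↦ iteratedDeriv m (fun s ↦ (((Λ i s : lorentzGroup) : E4 ≃L[ℝ] E4) (E4.basisVector 0))) t) atTop (𝓝 0)) ∧ (∀ m : ℕ, m ≤ 2 → Tendsto (fun t ↦ iteratedDeriv m (fun s ↦ deriv (ξ i) s - (((((Λ i s : lorentzGroup) : E4 ≃L[ℝ] E4) (E4.basisVector 0)) 0)⁻¹ • E4.spatial (((Λ i s : lorentzGroup) : E4 ≃L[ℝ] E4) (E4.basisVector 0)))) t) atTop (𝓝 0)) ∧ (a i ≠ 0 → ∀ m : ℕ, 1 ≤ m → m ≤ 3 → Tendsto (fun t ↦ iteratedDeriv m (fun s ↦ (((Λ i s : lorentzGroup) : E4 ≃L[ℝ] E4) (E4.basisVector 3))) t) atTop (𝓝 0))) →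
    (∃ τ₁ : ℝ, ∀ x y : U, (τ₁ < x.1 0 ∧ ∀ i, rin i < Kerr.radius (a i) (poincareInv (Λ i (x.1 0)) (E4.ofTimeSpace (x.1 0) (ξ i (x.1 0))) x.1)) → (τ₁ < y.1 0 ∧ ∀ i, rin i < Kerr.radius (a i) (poincareInv (Λ i (y.1 0)) (E4.ofTimeSpace (y.1 0) (ξ i (y.1 0))) y.1)) → Φ y ∈ 𝒟.metric.causalFuture 𝒟.timeOrientation {Φ x} → x.1 0 ≤ y.1 0) →
    ∀ (i : Fin N) (t : ℝ), 0 < (((Λ i t : lorentzGroup) : E4 ≃L[ℝ] E4) (E4.basisVector 0)) 0 := by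
  intro X _ _ _ _ _ _ D _ 𝒟 _ N M a rin Λ ξ γ κ τ₀ U Φ O hL hS hT
  obtain ⟨hsub, hγ, hsm, hsep, -, hU, hB⟩ := hL
  obtain ⟨hΦ, hemb, himO, hdev, -, hO, hexh⟩ := hB
  exact lorentz_apply_zero_pos_of_labTime 𝒟 M a rin Λ ξ γ τ₀ U Φ O hsub hγ hsm hsep hU hΦ hemb himO
    hdev hO hexh hS hT

/-- Registered one-line form (stub `neg_mem_lorentzGroup_rechart` of the crux item) of
`neg_mem_lorentzGroup`. [folklore] -/
theorem neg_mem_lorentzGroup_rechart : open Literature.Geometry.Lorentzian in (ContinuousLinearEquiv.neg ℝ : E4 ≃L[ℝ] E4) ∈ lorentzGroup :=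
  neg_mem_lorentzGroup

end Summit.FinalStateConjecture.FinalStateConjecture.Theorems
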